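import Literature.NumberTheory.LFunctions.FordProgram1Run05A
import Literature.NumberTheory.LFunctions.FordProgram1Run05B
import Literature.NumberTheory.LFunctions.FordProgram1Run05C
import HarnessLib

/-!
# Ford's "Program 1": kernel run 05 (`390 ≤ k ≤ 430`)

Topic `Literature/NumberTheory/LFunctions`. Everything here is PROVED (standard axioms):
`FordP1.checkT k = true` for `390 ≤ k ≤ 430`, i.e. the certified re-run of PROGRAM 1 of
K. Ford, Proc. LMS 85 (2002) (the second part of Theorem 3) for these `k` — see `FordProgram1.lean`
for the checker, its soundness `FordP1.row_of_checkK`, and the meaning of the constants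
(`ρ = FordP1.rhoOf k / 10⁵`, `θ = FordP1.thetaOf k / 10⁴`, `ω = FordP1.omOf k / 10⁴`).

This file originally did the whole range in ONE kernel evaluation
(`decide +kernel` on `(List.range' 390 41).all checkT`), which no longer completes within the
resources of the full build. The kernel work now lives in the split files
`FordProgram1Run05A.lean` (`390 ≤ k ≤ 403`),
`FordProgram1Run05B.lean` (`404 ≤ k ≤ 417`),
`FordProgram1Run05C.lean` (`418 ≤ k ≤ 430`)
— one `decide +kernel` per `k` — and the range statement `FordP1.run05` below (same statement as
before) is assembled from `FordP1.run05A/B/C` by an elementary case split, with no kernel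
evaluation in this file. The assembly of all runs is `FordTheorem3SmallK.lean` (which uses
`FordP1.run05` via `FordP1.checkT_of_all`).

## References

* K. Ford, Proc. London Math. Soc. (3) 85 (2002), 565–633; arXiv:1910.08209: Theorem 3, (1.7),
  Lemmas 3.4–3.5, Appendix "PROGRAM 1". [Ford2002]
-/

namespace Literature.NumberTheory.LFunctions
namespace FordP1

/-- **Kernel run 05**: `checkT k` for `390 ≤ k ≤ 430` (assembled from the split kernel runs
`run05A`, `run05B`, `run05C`). [cite: Ford2002, Theorem 3 (second part) and PROGRAM 1] -/
theorem run05 : ((List.range' 390 41).all checkT) = true := by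
  rw [List.all_eq_true]
  intro k hk
  obtain ⟨h1, h2⟩ := List.mem_range'_1.mp hk
  rcases lt_or_ge k 404 with hA | hA
  · exact run05A k h1 (by omega)
  rcases lt_or_ge k 418 with hB | hB
  · exact run05B k hA (by omega)
  exact run05C k hB (by omega)

end FordP1
end Literature.NumberTheory.LFunctions
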